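import Literature.AlgebraicGeometry.Motives.HodgeLieWeightOneProjector
import HarnessLib

/-!
# The `𝔰𝔩₂`-triple of a weight-one Hodge structure with `dim Hg ≤ 3` which is not of CM type: `(Lie Hg)_ℂ =
# ℂ(2P − 1) ⊕ ℂE ⊕ ℂF`, `E F = α P`, `F E = α (1 − P)` with `α ≠ 0`, and `End_Hdg ⊗ ℂ` is its commutant

Family `hodge`, layer `Literature/AlgebraicGeometry/Motives`; THEOREMS ONLY (no definition, no named fact; D-0026).
Part 1 of the abstract heart of the cell `pub-hodgecm2` (COR-CM) lane MT-RANK-FOUR; part 2 is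
`Motives/HodgeLieWeightOneRankThree` (`dim_ℚ End_Hdg(V) = g²`, centre `ℚ`), the geometric reading
`Summits/HodgeConjecture/CorCM/MumfordTateRankFour`.

SETTING.  `H` a pure `ℚ`-Hodge structure of weight `n = 1` on a finite-dimensional `V`, `e` a graded basis adapted to
`H` with degrees in `{0,1}` (effective weight one), `P = gradingEnd e deg` the projector onto `V^{1,0}` (`P² = P`,
`Motives/HodgeLieWeightOneProjector`), `𝔥 = H.hodgeLie = Lie Hg(H)`, `𝔥_ℂ = H.hodgeLieC`, `End_Hdg(V) = H.endAlg`;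
`X ∈ 𝔥 ∖ End_Hdg(V)` a rational element, `E = P X_ℂ (1 − P)`, `F = (1 − P) X_ℂ P` its off-diagonal blocks, and
**`dim_ℚ 𝔥 ≤ 3`**.

* `exists_coeffs_of_mem_hodgeLieC` — **`𝔥_ℂ = ℂ (2P − 1) ⊕ ℂ E ⊕ ℂ F`** (the three lie in `𝔥_ℂ`, are linearly independent
  — the `P·P`-corner and left multiplication by `P` separate them, `E, F ≠ 0` — and `dim_ℂ 𝔥_ℂ = dim_ℚ 𝔥 ≤ 3`).
* `exists_projE_mul_projF_eq_smul` — with a polarization `ψ`: **`E F = α P`, `F E = α (1 − P)`, `α ≠ 0`**: the commutator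
  `[E, F] ∈ 𝔥_ℂ` has `P`-corner `E F` and `(1 − P)`-corner `−F E`; were `α = 0`, for `u = F v ≠ 0` in `V^{0,1}` one gets
  `ψ_ℂ(u, ū) = ψ_ℂ(F v, E v̄) = −ψ_ℂ(v, F E v̄) = 0` (`F ∈ 𝔥_ℂ` is `ψ_ℂ`-skew, `conj` exchanges the blocks of the rational
  `X`), against the second Hodge–Riemann relation.
* `mem_span_endAlg_iff_commute` — **`End_Hdg(V) ⊗ ℂ = span_ℂ {a_ℂ}` is exactly the commutant of `{P, E, F}`**
  (`mem_span_endAlg_of_forall_commute`; `commute_baseChange_of_mem_hodgeLieC`).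
* `two_mul_finrank_range_gradingEnd` — **`2 dim_ℂ V^{1,0} = dim_ℚ V`** (`E`, `F` are isomorphisms `V^{0,1} ⇄ V^{1,0}` up
  to `α`).

Classically: `Hg_ℂ = SL₂` and `V_ℂ = std ⊗ V^{1,0}` (Moonen–Zarhin 1999 §2; Fulton–Harris Lecture 11); the proofs here
are projector calculus plus the Hodge–Riemann relations, no structure theory of algebraic groups.

## References

* [MoonenZarhin1999LowDim] B. Moonen, Yu. Zarhin, *Hodge classes on abelian varieties of low dimension*, Math. Ann. 315
  (1999), §2 (Hodge group, `MT = 𝔾ₘ·Hg`, `End⁰(X) = End_{Hg}(H¹)`).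
* [Deligne1982HodgeCycles] P. Deligne, *Hodge cycles on abelian varieties*, LNM 900 (1982), I §3 (3.1–3.4).
* [FultonHarris1991] W. Fulton, J. Harris, *Representation Theory*, GTM 129 (1991), Lecture 11 (§11.1).
* [Huybrechts2016K3] D. Huybrechts, *Lectures on K3 Surfaces* (2016), §3.3.4, Thm. 3.3.9 (`Hg ⊆ Sp(ψ)`, commutant).
-/
noncomputable section

open scoped TensorProduct

namespace Literature.AlgebraicGeometry.Motives

universe u

namespace HodgeStructure

/-! ## §0 Corner identities for a projector `P` and its off-diagonal blocks (private algebra) -/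

section Corner

variable {R : Type*} [Ring R] {P E F : R}

/-- `P [E, F] P = E F`. [folklore] -/
private theorem corner_P_comm (hPE : P * E = E) (hPF : P * F = 0) (hFP : F * P = F) :
    P * (E * F - F * E) * P = E * F := by
  rw [mul_sub P (E * F) (F * E), sub_mul (P * (E * F)) (P * (F * E)) P, ← mul_assoc P E F, hPE,
    mul_assoc E F P, hFP, ← mul_assoc P F E, hPF, zero_mul, zero_mul, sub_zero]

/-- `(1 − P) [E, F] (1 − P) = −F E`. [folklore] -/
private theorem corner_Q_comm (hPE : P * E = E) (hEP : E * P = 0) (hPF : P * F = 0) :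
    (1 - P) * (E * F - F * E) * (1 - P) = -(F * E) := by
  have hQE : (1 - P) * E = 0 := by rw [sub_mul, one_mul, hPE, sub_self]
  have hQF : (1 - P) * F = F := by rw [sub_mul, one_mul, hPF, sub_zero]
  have hEQ : E * (1 - P) = E := by rw [mul_sub, mul_one, hEP, sub_zero]
  rw [mul_sub (1 - P) (E * F) (F * E), sub_mul ((1 - P) * (E * F)) ((1 - P) * (F * E)) (1 - P),
    ← mul_assoc (1 - P) E F, hQE, zero_mul, zero_mul, zero_sub, ← mul_assoc (1 - P) F E, hQF,
    mul_assoc F E (1 - P), hEQ]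

variable [Algebra ℂ R]

/-- `P (c₀ (2P − 1) + c₁ E + c₂ F) P = c₀ P`. [folklore] -/
private theorem corner_P_smul (hPP : P * P = P) (hPE : P * E = E) (hEP : E * P = 0) (hPF : P * F = 0)
    (c₀ c₁ c₂ : ℂ) : P * (c₀ • ((2 : ℂ) • P - 1) + c₁ • E + c₂ • F) * P = c₀ • P := by
  have hPEP : P * E * P = 0 := by rw [hPE, hEP]
  have hPFP : P * F * P = 0 := by rw [hPF, zero_mul]
  have hPΘP : P * ((2 : ℂ) • P - 1) * P = P := by
    rw [mul_sub P ((2 : ℂ) • P) 1, sub_mul, mul_one, mul_smul_comm, smul_mul_assoc, hPP, hPP, two_smul,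
      add_sub_cancel_right]
  simp only [mul_add, add_mul, mul_smul_comm, smul_mul_assoc, hPEP, hPFP, hPΘP, smul_zero, add_zero]

/-- `(1 − P) (c₀ (2P − 1) + c₁ E + c₂ F) (1 − P) = −c₀ (1 − P)`. [folklore] -/
private theorem corner_Q_smul (hPP : P * P = P) (hPE : P * E = E) (hPF : P * F = 0) (hFP : F * P = F)
    (c₀ c₁ c₂ : ℂ) :
    (1 - P) * (c₀ • ((2 : ℂ) • P - 1) + c₁ • E + c₂ • F) * (1 - P) = -(c₀ • (1 - P)) := by
  have hQE : (1 - P) * E = 0 := by rw [sub_mul, one_mul, hPE, sub_self]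
  have hFQ : F * (1 - P) = 0 := by rw [mul_sub, mul_one, hFP, sub_self]
  have hQF : (1 - P) * F = F := by rw [sub_mul, one_mul, hPF, sub_zero]
  have hQEQ : (1 - P) * E * (1 - P) = 0 := by rw [hQE, zero_mul]
  have hQFQ : (1 - P) * F * (1 - P) = 0 := by rw [hQF, hFQ]
  have hQP : (1 - P) * P = 0 := by rw [sub_mul, one_mul, hPP, sub_self]
  have hQQ : (1 - P) * (1 - P) = 1 - P := by rw [mul_sub (1 - P) 1 P, mul_one, hQP, sub_zero]
  have hQΘQ : (1 - P) * ((2 : ℂ) • P - 1) * (1 - P) = -(1 - P) := by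
    rw [mul_sub (1 - P) ((2 : ℂ) • P) 1, mul_smul_comm, hQP, smul_zero, zero_sub, mul_one, neg_mul, hQQ]
  simp only [mul_add, add_mul, mul_smul_comm, smul_mul_assoc, hQEQ, hQFQ, hQΘQ, smul_zero, add_zero, smul_neg]

end Corner

variable {V : Type u} [AddCommGroup V] [Module ℚ V] [Module.Finite ℚ V] [HodgeTensorFacts.{u, u}] {n : ℤ}
  {S : Type u} [Fintype S] [DecidableEq S] {deg : S → ℤ}

/-! ## §1 The `𝔰𝔩₂`-triple of a weight-one Hodge structure of Hodge-group rank `3` -/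

/-- **`𝔥_ℂ = ℂ (2P − 1) ⊕ ℂ E ⊕ ℂ F`.**  For `X ∈ 𝔥 ∖ End_Hdg(V)` and `dim_ℚ 𝔥 ≤ 3` (weight `1`, degrees in `{0,1}`),
every `Z ∈ 𝔥_ℂ` is `c₀ (2P − 1) + c₁ E + c₂ F` with `E = P X_ℂ (1 − P)`, `F = (1 − P) X_ℂ P`: the three lie in `𝔥_ℂ`
(`two_smul_gradingEnd_sub_mem_hodgeLieC`, `projE_mem_hodgeLieC`), are linearly independent (`P · P`-corner and
left multiplication by `P` separate them; `E, F ≠ 0` by `projE_ne_zero_of_not_mem_endAlg`), and `dim_ℂ 𝔥_ℂ = dim_ℚ 𝔥 ≤ 3`.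
[cite: MoonenZarhin1999LowDim, §2] [cite: Deligne1982HodgeCycles, I §3 (proof of Prop. 3.4)] -/
theorem exists_coeffs_of_mem_hodgeLieC (H : HodgeStructure V n) (hn : n = 1) (e : Module.Basis S ℂ (ℂ ⊗[ℚ] V))
    (hF : ∀ a, H.F a = Submodule.span ℂ (e '' {σ | a ≤ deg σ}))
    (hFc : ∀ a, complexConj (H.F a) = Submodule.span ℂ (e '' {σ | deg σ ≤ n - a}))
    (hdeg : ∀ σ, deg σ = 0 ∨ deg σ = 1) {X : Module.End ℚ V} (hX : X ∈ H.hodgeLie) (hXE : X ∉ H.endAlg)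
    (h3 : Module.finrank ℚ H.hodgeLie ≤ 3) {Z : Module.End ℂ (ℂ ⊗[ℚ] V)} (hZ : Z ∈ H.hodgeLieC) :
    ∃ c : Fin 3 → ℂ, Z = c 0 • ((2 : ℂ) • gradingEnd e deg - 1) +
      c 1 • (gradingEnd e deg * X.baseChange ℂ * (1 - gradingEnd e deg)) +
      c 2 • ((1 - gradingEnd e deg) * X.baseChange ℂ * gradingEnd e deg) := by
  classical
  subst hn
  set P := gradingEnd e deg with hP
  set Y := X.baseChange ℂ with hY
  set E := P * Y * (1 - P) with hEdef
  set F := (1 - P) * Y * P with hFdef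
  have hPP : P * P = P := gradingEnd_mul_gradingEnd_of_deg e hdeg
  have hPE : P * E = E := by rw [hEdef, ← mul_assoc, ← mul_assoc, hPP]
  have hEP : E * P = 0 := by rw [hEdef, mul_assoc (P * Y) (1 - P) P, sub_mul, one_mul, hPP, sub_self, mul_zero]
  have hPF : P * F = 0 := by
    rw [hFdef, mul_assoc (1 - P) Y P, ← mul_assoc P (1 - P) (Y * P), mul_sub, mul_one, hPP, sub_self, zero_mul]
  obtain ⟨hE0, hF0⟩ := projE_ne_zero_of_not_mem_endAlg H rfl e hF hFc hdeg hXE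
  rw [← hP, ← hY, ← hEdef] at hE0
  rw [← hP, ← hY, ← hFdef] at hF0
  have hP0 : P ≠ 0 := by
    intro h
    apply hE0
    rw [hEdef, h, zero_mul, zero_mul]
  -- the three elements of `𝔥_ℂ`
  have hΘ' : (2 : ℂ) • P - 1 ∈ H.hodgeLieC := by
    have h := two_smul_gradingEnd_sub_mem_hodgeLieC H e hF hFc
    rw [Int.cast_one, one_smul] at h
    exact h
  have hYM : Y ∈ H.hodgeLieC := H.baseChange_mem_hodgeLieC hX
  obtain ⟨hEM, hFM⟩ := projE_mem_hodgeLieC H e hF hFc hdeg hYM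
  rw [← hP, ← hEdef] at hEM
  rw [← hP, ← hFdef] at hFM
  let v : Fin 3 → Module.End ℂ (ℂ ⊗[ℚ] V) := ![(2 : ℂ) • P - 1, E, F]
  have hv : ∀ i, v i ∈ H.hodgeLieC := by
    intro i
    fin_cases i
    · exact hΘ'
    · exact hEM
    · exact hFM
  -- linear independence
  have hli : LinearIndependent ℂ v := by
    rw [Fintype.linearIndependent_iff]
    intro g hg
    have hg' : g 0 • ((2 : ℂ) • P - 1) + g 1 • E + g 2 • F = 0 := by
      simpa [Fin.sum_univ_three, v] using hg
    have hg0 : g 0 = 0 := by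
      have h : P * (g 0 • ((2 : ℂ) • P - 1) + g 1 • E + g 2 • F) * P = P * 0 * P :=
        congrArg (fun T : Module.End ℂ (ℂ ⊗[ℚ] V) => P * T * P) hg'
      rw [corner_P_smul hPP hPE hEP hPF, mul_zero, zero_mul] at h
      exact (smul_eq_zero.1 h).resolve_right hP0
    rw [hg0, zero_smul, zero_add] at hg'
    have hg1 : g 1 = 0 := by
      have h : P * (g 1 • E + g 2 • F) = P * 0 := congrArg (fun T : Module.End ℂ (ℂ ⊗[ℚ] V) => P * T) hg'
      rw [mul_add, mul_smul_comm, mul_smul_comm, hPE, hPF, smul_zero, add_zero, mul_zero] at h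
      exact (smul_eq_zero.1 h).resolve_right hE0
    rw [hg1, zero_smul, zero_add] at hg'
    have hg2 : g 2 = 0 := (smul_eq_zero.1 hg').resolve_right hF0
    intro i
    fin_cases i
    · exact hg0
    · exact hg1
    · exact hg2
  -- `span (range v) = 𝔥_ℂ` by dimension
  have hle : Submodule.span ℂ (Set.range v) ≤ H.hodgeLieC := by
    rw [Submodule.span_le]
    rintro _ ⟨i, rfl⟩
    exact hv i
  have hdim : Module.finrank ℂ H.hodgeLieC ≤ Module.finrank ℂ (Submodule.span ℂ (Set.range v)) := by
    rw [finrank_span_eq_card hli, Fintype.card_fin, finrank_hodgeLieC]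
    exact h3
  have heq : Submodule.span ℂ (Set.range v) = H.hodgeLieC := Submodule.eq_of_le_of_finrank_le hle hdim
  rw [← heq, Submodule.mem_span_range_iff_exists_fun] at hZ
  obtain ⟨c, hc⟩ := hZ
  refine ⟨c, ?_⟩
  rw [← hc, Fin.sum_univ_three]
  rfl

/-- **`E F = α P` and `F E = α (1 − P)` with `α ≠ 0`** (same setting, `ψ` a polarization).  The commutator
`[E, F] ∈ 𝔥_ℂ = ℂ (2P − 1) ⊕ ℂ E ⊕ ℂ F` has `P`-corner `E F` and `(1 − P)`-corner `−F E`, whence `E F = α P`,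
`F E = α (1 − P)`.  If `α = 0`, pick `v` with `u = F v ≠ 0`; `u ∈ V^{0,1}` and `conj u = E (conj v)` (conjugation
exchanges the blocks of the rational `X`), so `ψ_ℂ(u, conj u) = −ψ_ℂ(v, F E (conj v)) = 0` (`F ∈ 𝔥_ℂ` is `ψ_ℂ`-skew),
contradicting the second Hodge–Riemann relation `i⁻¹ ψ_ℂ(u, ū) > 0`.
[cite: MoonenZarhin1999LowDim, §2] [cite: Huybrechts2016K3, Thm. 3.3.9 (proof, p. 67)] [cite: FultonHarris1991, Lecture 11 (§11.1)] -/
theorem exists_projE_mul_projF_eq_smul (H : HodgeStructure V n) (ψ : H.Polarization) (hn : n = 1)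
    (e : Module.Basis S ℂ (ℂ ⊗[ℚ] V)) (hF : ∀ a, H.F a = Submodule.span ℂ (e '' {σ | a ≤ deg σ}))
    (hFc : ∀ a, complexConj (H.F a) = Submodule.span ℂ (e '' {σ | deg σ ≤ n - a}))
    (hdeg : ∀ σ, deg σ = 0 ∨ deg σ = 1) {X : Module.End ℚ V} (hX : X ∈ H.hodgeLie) (hXE : X ∉ H.endAlg)
    (h3 : Module.finrank ℚ H.hodgeLie ≤ 3) :
    ∃ α : ℂ, α ≠ 0 ∧
      (gradingEnd e deg * X.baseChange ℂ * (1 - gradingEnd e deg)) * ((1 - gradingEnd e deg) * X.baseChange ℂ *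
        gradingEnd e deg) = α • gradingEnd e deg ∧
      ((1 - gradingEnd e deg) * X.baseChange ℂ * gradingEnd e deg) * (gradingEnd e deg * X.baseChange ℂ *
        (1 - gradingEnd e deg)) = α • (1 - gradingEnd e deg) := by
  classical
  set P := gradingEnd e deg with hP
  set Y := X.baseChange ℂ with hY
  set E := P * Y * (1 - P) with hEdef
  set F := (1 - P) * Y * P with hFdef
  have hPP : P * P = P := gradingEnd_mul_gradingEnd_of_deg e hdeg
  have hPE : P * E = E := by rw [hEdef, ← mul_assoc, ← mul_assoc, hPP]
  have hEP : E * P = 0 := by rw [hEdef, mul_assoc (P * Y) (1 - P) P, sub_mul, one_mul, hPP, sub_self, mul_zero]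
  have hPF : P * F = 0 := by
    rw [hFdef, mul_assoc (1 - P) Y P, ← mul_assoc P (1 - P) (Y * P), mul_sub, mul_one, hPP, sub_self, zero_mul]
  have hFP : F * P = F := by rw [hFdef, mul_assoc ((1 - P) * Y) P P, hPP]
  have hYM : Y ∈ H.hodgeLieC := H.baseChange_mem_hodgeLieC hX
  obtain ⟨hEM, hFM⟩ := projE_mem_hodgeLieC H e hF hFc hdeg hYM
  rw [← hP, ← hEdef] at hEM
  rw [← hP, ← hFdef] at hFM
  obtain ⟨hE0, hF0⟩ := projE_ne_zero_of_not_mem_endAlg H hn e hF hFc hdeg hXE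
  rw [← hP, ← hY, ← hEdef] at hE0
  rw [← hP, ← hY, ← hFdef] at hF0
  -- `[E, F] = c₀ (2P - 1) + c₁ E + c₂ F`
  obtain ⟨c, hc⟩ := exists_coeffs_of_mem_hodgeLieC H hn e hF hFc hdeg hX hXE h3 (H.commutator_mem_hodgeLieC hEM hFM)
  rw [← hP, ← hY, ← hEdef, ← hFdef] at hc
  -- `P`-corner: `E F = c₀ P`
  have hEF : E * F = c 0 • P := by
    have h : P * (E * F - F * E) * P = P * (c 0 • ((2 : ℂ) • P - 1) + c 1 • E + c 2 • F) * P :=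
      congrArg (fun T : Module.End ℂ (ℂ ⊗[ℚ] V) => P * T * P) hc
    rwa [corner_P_comm hPE hPF hFP, corner_P_smul hPP hPE hEP hPF] at h
  -- `(1 - P)`-corner: `F E = c₀ (1 - P)`
  have hFE : F * E = c 0 • (1 - P) := by
    have h : (1 - P) * (E * F - F * E) * (1 - P) =
        (1 - P) * (c 0 • ((2 : ℂ) • P - 1) + c 1 • E + c 2 • F) * (1 - P) :=
      congrArg (fun T : Module.End ℂ (ℂ ⊗[ℚ] V) => (1 - P) * T * (1 - P)) hc
    rwa [corner_Q_comm hPE hEP hPF, corner_Q_smul hPP hPE hPF hFP, neg_inj] at h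
  refine ⟨c 0, ?_, hEF, hFE⟩
  -- `α ≠ 0` by the second Hodge–Riemann relation
  intro hα
  rw [hα, zero_smul] at hEF hFE
  obtain ⟨v, hv⟩ : ∃ v, F v ≠ 0 := by
    by_contra h
    push Not at h
    exact hF0 (LinearMap.ext fun v => by rw [h v, LinearMap.zero_apply])
  subst hn
  -- `F v ∈ V^{0,1}`
  have hmem : F v ∈ H.piece 0 ((1 : ℤ) - 0) := by
    rw [piece_eq_span_of_graded H e hF hFc 0, hFdef, Module.End.mul_apply, Module.End.mul_apply]
    exact one_sub_gradingEnd_apply_mem_span_zero e hdeg _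
  obtain ⟨r, hr, hre⟩ := ψ.pos 0 ((1 : ℤ) - 0) (by ring) (F v) hmem hv
  -- `conj (F v) = E (conj v)` and `ψ_ℂ (F v, E (conj v)) = -ψ_ℂ (v, F E (conj v)) = 0`
  have hconj : conj (F v) = E (conj v) := by
    have h := conj_projF_conj_apply H rfl e hF hFc X (conj v)
    rw [conj_conj] at h
    exact h
  have hzero : ψ.form.baseChange ℂ (F v) (conj (F v)) = 0 := by
    rw [hconj, formBaseChange_skew_of_mem_hodgeLieC ψ hFM v (E (conj v)), ← Module.End.mul_apply, hFE,
      LinearMap.zero_apply, map_zero, neg_zero]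
  rw [hzero, mul_zero] at hre
  have hr0 : (r : ℂ) = 0 := hre.symm
  exact hr.ne' (by exact_mod_cast hr0)

/-- **`End_Hdg(V) ⊗ ℂ` is the commutant of `{P, E, F}`**: a `ℂ`-linear `T` on `V_ℂ` lies in
`span_ℂ {a_ℂ | a ∈ End_Hdg(V)}` iff it commutes with `P`, `E = P X_ℂ (1 − P)` and `F = (1 − P) X_ℂ P` (the commutant of
`𝔥_ℂ = ℂ(2P − 1) ⊕ ℂE ⊕ ℂF` is `End_Hdg ⊗ ℂ`, `mem_span_endAlg_of_forall_commute`; conversely Hodge endomorphisms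
commute with `𝔥_ℂ`, `commute_baseChange_of_mem_hodgeLieC`). [cite: Huybrechts2016K3, §3.3.4 (p. 66)]
[cite: MoonenZarhin1999LowDim, §2] -/
theorem mem_span_endAlg_iff_commute (H : HodgeStructure V n) (hn : n = 1) (e : Module.Basis S ℂ (ℂ ⊗[ℚ] V))
    (hF : ∀ a, H.F a = Submodule.span ℂ (e '' {σ | a ≤ deg σ}))
    (hFc : ∀ a, complexConj (H.F a) = Submodule.span ℂ (e '' {σ | deg σ ≤ n - a}))
    (hdeg : ∀ σ, deg σ = 0 ∨ deg σ = 1) {X : Module.End ℚ V} (hX : X ∈ H.hodgeLie) (hXE : X ∉ H.endAlg)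
    (h3 : Module.finrank ℚ H.hodgeLie ≤ 3) (T : Module.End ℂ (ℂ ⊗[ℚ] V)) :
    T ∈ Submodule.span ℂ ((fun a : Module.End ℚ V => a.baseChange ℂ) '' (H.endAlg : Set (Module.End ℚ V))) ↔
      (T * gradingEnd e deg = gradingEnd e deg * T ∧
        T * (gradingEnd e deg * X.baseChange ℂ * (1 - gradingEnd e deg)) =
          (gradingEnd e deg * X.baseChange ℂ * (1 - gradingEnd e deg)) * T ∧
        T * ((1 - gradingEnd e deg) * X.baseChange ℂ * gradingEnd e deg) =
          ((1 - gradingEnd e deg) * X.baseChange ℂ * gradingEnd e deg) * T) := by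
  classical
  set P := gradingEnd e deg with hP
  set Y := X.baseChange ℂ with hY
  -- commutation with the three generators of `𝔥_ℂ`
  have hΘ' : (2 : ℂ) • P - 1 ∈ H.hodgeLieC := by
    have h := two_smul_gradingEnd_sub_mem_hodgeLieC H e hF hFc
    have h1 : ((n : ℤ) : ℂ) • (1 : Module.End ℂ (ℂ ⊗[ℚ] V)) = 1 := by rw [hn, Int.cast_one, one_smul]
    rw [h1] at h
    exact h
  have hYM : Y ∈ H.hodgeLieC := H.baseChange_mem_hodgeLieC hX
  obtain ⟨hEM, hFM⟩ := projE_mem_hodgeLieC H e hF hFc hdeg hYM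
  rw [← hP] at hEM hFM
  constructor
  · intro hT
    -- `T` commutes with all of `𝔥_ℂ`
    have hcomm : ∀ Z ∈ H.hodgeLieC, T * Z = Z * T := by
      intro Z hZ
      induction hT using Submodule.span_induction with
      | mem T' hT' =>
        obtain ⟨a, ha, rfl⟩ := hT'
        exact (commute_baseChange_of_mem_hodgeLieC H hZ ⟨a, ha⟩).symm
      | zero => rw [zero_mul, mul_zero]
      | add T₁ T₂ _ _ h₁ h₂ => rw [add_mul, mul_add, h₁, h₂]
      | smul c T₁ _ h₁ => rw [smul_mul_assoc, mul_smul_comm, h₁]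
    refine ⟨?_, hcomm _ hEM, hcomm _ hFM⟩
    have h := hcomm _ hΘ'
    rw [mul_sub, sub_mul, mul_one, one_mul, mul_smul_comm, smul_mul_assoc, sub_left_inj] at h
    exact smul_right_injective _ (two_ne_zero : (2 : ℂ) ≠ 0) h
  · rintro ⟨hTP, hTE, hTF⟩
    have hTΘ : T * ((2 : ℂ) • P - 1) = ((2 : ℂ) • P - 1) * T := by
      rw [mul_sub, sub_mul, mul_smul_comm, smul_mul_assoc, hTP, mul_one, one_mul]
    refine H.mem_span_endAlg_of_forall_commute fun X' hX' => ?_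
    obtain ⟨c, hc⟩ := exists_coeffs_of_mem_hodgeLieC H hn e hF hFc hdeg hX hXE h3 (H.baseChange_mem_hodgeLieC hX')
    rw [← hP, ← hY] at hc
    rw [hc, mul_add, mul_add, add_mul, add_mul, mul_smul_comm, mul_smul_comm, mul_smul_comm, smul_mul_assoc,
      smul_mul_assoc, smul_mul_assoc, hTΘ, hTE, hTF]

/-- **`2 · dim_ℂ V^{1,0} = dim_ℚ V`** in the same setting (`E : V^{0,1} ⥲ V^{1,0}` and `F : V^{1,0} ⥲ V^{0,1}` are
isomorphisms up to `α`: `range P ⊆ range E`, `E = E (1 − P)` bounds `rk P` by `dim ker P`, and symmetrically).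
Here `V^{1,0} = range P`. [cite: MoonenZarhin1999LowDim, §2] [cite: FultonHarris1991, Lecture 11 (§11.1)] -/
theorem two_mul_finrank_range_gradingEnd (H : HodgeStructure V n) (ψ : H.Polarization) (hn : n = 1)
    (e : Module.Basis S ℂ (ℂ ⊗[ℚ] V)) (hF : ∀ a, H.F a = Submodule.span ℂ (e '' {σ | a ≤ deg σ}))
    (hFc : ∀ a, complexConj (H.F a) = Submodule.span ℂ (e '' {σ | deg σ ≤ n - a}))
    (hdeg : ∀ σ, deg σ = 0 ∨ deg σ = 1) {X : Module.End ℚ V} (hX : X ∈ H.hodgeLie) (hXE : X ∉ H.endAlg)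
    (h3 : Module.finrank ℚ H.hodgeLie ≤ 3) :
    2 * Module.finrank ℂ (LinearMap.range (gradingEnd e deg)) = Module.finrank ℚ V := by
  classical
  obtain ⟨α, hα, hEF, hFE⟩ := exists_projE_mul_projF_eq_smul H ψ hn e hF hFc hdeg hX hXE h3
  set P := gradingEnd e deg with hP
  set Y := X.baseChange ℂ with hY
  set E := P * Y * (1 - P) with hEdef
  set F := (1 - P) * Y * P with hFdef
  have hPP : P * P = P := gradingEnd_mul_gradingEnd_of_deg e hdeg
  have hEP : E * P = 0 := by rw [hEdef, mul_assoc (P * Y) (1 - P) P, sub_mul, one_mul, hPP, sub_self, mul_zero]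
  have hFP : F * P = F := by rw [hFdef, mul_assoc ((1 - P) * Y) P P, hPP]
  -- `range P ≤ range E`, `range E = (range (1 - P)).map E`, `range (1 - P) ≤ ker P`
  have h1 : Module.finrank ℂ (LinearMap.range P) ≤ Module.finrank ℂ (LinearMap.ker P) := by
    have hPle : LinearMap.range P ≤ LinearMap.range E := by
      rintro _ ⟨u, rfl⟩
      refine ⟨α⁻¹ • F u, ?_⟩
      rw [map_smul, ← Module.End.mul_apply, hEF, LinearMap.smul_apply, smul_smul, inv_mul_cancel₀ hα, one_smul]
    have hEeq : LinearMap.range E = (LinearMap.range (1 - P)).map E := by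
      rw [← LinearMap.range_comp, ← Module.End.mul_eq_comp, mul_sub, mul_one, hEP, sub_zero]
    have hQle : LinearMap.range (1 - P) ≤ LinearMap.ker P := by
      rintro _ ⟨u, rfl⟩
      rw [LinearMap.mem_ker, ← Module.End.mul_apply, mul_sub, mul_one, hPP, sub_self, LinearMap.zero_apply]
    calc Module.finrank ℂ (LinearMap.range P) ≤ Module.finrank ℂ (LinearMap.range E) := Submodule.finrank_mono hPle
      _ ≤ Module.finrank ℂ (LinearMap.range (1 - P)) := by rw [hEeq]; exact Submodule.finrank_map_le _ _
      _ ≤ Module.finrank ℂ (LinearMap.ker P) := Submodule.finrank_mono hQle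
  -- `ker P ≤ range (1 - P) ≤ range F = (range P).map F`
  have h2 : Module.finrank ℂ (LinearMap.ker P) ≤ Module.finrank ℂ (LinearMap.range P) := by
    have hKle : LinearMap.ker P ≤ LinearMap.range F := by
      intro u hu
      rw [LinearMap.mem_ker] at hu
      refine ⟨α⁻¹ • E u, ?_⟩
      rw [map_smul, ← Module.End.mul_apply, hFE, LinearMap.smul_apply, LinearMap.sub_apply, Module.End.one_apply,
        hu, sub_zero, smul_smul, inv_mul_cancel₀ hα, one_smul]
    have hFeq : LinearMap.range F = (LinearMap.range P).map F := by
      rw [← LinearMap.range_comp, ← Module.End.mul_eq_comp, hFP]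
    calc Module.finrank ℂ (LinearMap.ker P) ≤ Module.finrank ℂ (LinearMap.range F) := Submodule.finrank_mono hKle
      _ ≤ Module.finrank ℂ (LinearMap.range P) := by rw [hFeq]; exact Submodule.finrank_map_le _ _
  have hrn := LinearMap.finrank_range_add_finrank_ker P
  rw [Module.finrank_baseChange] at hrn
  omega

end HodgeStructure

end Literature.AlgebraicGeometry.Motives

end
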